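import Summits.QuantumFields.YangMills.Theorems.BalabanLadderIRLightCodeDefs
import Summits.QuantumFields.YangMills.Theorems.LangevinControlUVOSLegsFromFemtoAndGapDefs
import Literature.MathematicalPhysics.QuantumLattice.EuclideanAction
import HarnessLib

/-!
# Route `BalabanLadder`, crux `IR` (stmt-QuantumFields-19354): the hypothesis bundle of the flux-code pincer

Route-posited object (D-0016 `<Route><Crux>Defs` file), kept apart from `BalabanLadderIRLightCodeDefs` because it is stated
in the `DlrCollarTransfer` vocabulary of the crux `IR` itself (`Q2`, the reflected smeared two-point function of the action
density; module `LangevinControlUVOSLegsFromFemtoAndGapDefs`, cone of route file `LangevinControlUV`), while the light-code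
vocabulary proper is route-independent.  Source: crux-idea card `Cruxes/IR/Ideas/ym19354-5-flux-code-blindness.md` (seat
`ym-cruxidea-19354-5` gen 3; `Sketch-g3.lean` rev 3 sha16 `c463f541daed4b01`, evidence #48 on stmt-QuantumFields-19354),
landed per route-owner ruling R34 (ym-beyond-p2 g25, 2026-08-27).

* `LightCodePincerInputs` — the OPEN, engine-level hypothesis of the kernel-checked reduction
  `IR_of_lightCodePincer : LightCodePincerInputs → Theses.BalabanLadder.IR` (`BalabanLadderIRLightCodePincer`): per compact
  simple `G` and lattice representation `r`, (I_code) a light rank `Q`, a width map, a light-code length `ξ(β) ≥ 1` with the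
  certificate `LightCodeCertificateAt r β Q (1/ξ β) wd` for `β ≥ β₂`, and (X) asymptotic freedom below `ξ(β)` in the
  `Q2`-currency of `LowerBounds` (af-pincer's stub X with that length).

NOTHING is asserted; this is not a literature fact (its weak-coupling producers — flux-sector quasi-conservation, sector-mean
blindness, sector cold pressure; asymptotic freedom of the reflected two-point function — are untyped engines, card §What it
needs).  HONEST FRAMING: hypothesis of a conditional reduction inside a conditional chain; not a gap claim.
-/

set_option autoImplicit false

noncomputable section

open scoped SchwartzMap
open Literature.MathematicalPhysics.QuantumFieldTheory Literature.MathematicalPhysics.QuantumLattice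
open Summit.QuantumFields.YangMills.Cruxes.OSLegsFromFemtoAndGap.DlrCollarTransfer (Q2)

namespace Summit.QuantumFields.YangMills.Cruxes.IR.FluxCodeBlindness

/-- **Light-code pincer inputs** (all compact simple `G`, simply connected or not) — the OPEN hypothesis bundle of the
reduction `IR_of_lightCodePincer` (`BalabanLadderIRLightCodePincer`): for every faithful `r` a light rank `Q` (physically
`|π₁(G)|³ − 1`), a width map, a per-β LIGHT-CODE LENGTH `ξ(β) ≥ 1` with the certificate at rate `1/ξ(β)` for `β ≥ β₂`
(stub I_code — sector cold pressure + code, periodic tori only, NO boundary datum), and af-pincer's stub X with that length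
(asymptotic freedom below `ξ(β)`: the reflected two-point function `Q2` is small INFINITELY OFTEN in the volume once
`s · ξ(β) ≥ T`).  At `π₁(G) = 1`, `Q = 0` and I_code is the cold-pressure onset format (`lightCodeModel_rank_zero`).
Nothing is asserted. -/
def LightCodePincerInputs : Prop :=
  ∀ (G : Type) [Group G] [TopologicalSpace G] [IsTopologicalGroup G] [CompactSpace G],
    IsCompactSimpleLieGroup G → letI : MeasurableSpace G := borel G; haveI : BorelSpace G := ⟨rfl⟩;
    ∀ r : LatticeRep G, ∃ (Q : ℕ) (wd : YMSpecies G → YMSpecies G → ℕ) (ξ : ℝ → ℕ) (β₂ : ℝ),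
      (∀ β : ℝ, β₂ ≤ β → 1 ≤ ξ β ∧ LightCodeCertificateAt r β Q (1 / (ξ β : ℝ)) wd) ∧
      (∀ v : 𝓢(EuclideanSpace ℝ (Fin 4), ℝ), tsupport v ⊆ {y : EuclideanSpace ℝ (Fin 4) | 0 < y 0} →
        ∀ η : ℝ, 0 < η → ∃ T β₁ : ℝ, ∀ β : ℝ, β₁ ≤ β → ∀ s : ℝ, 0 < s →
          T ≤ s * (ξ β : ℝ) → ∃ᶠ (L : ℕ) in Filter.atTop, |Q2 G r β L s (thetaTest 4 v) v| ≤ η)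

end Summit.QuantumFields.YangMills.Cruxes.IR.FluxCodeBlindness

end
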